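import Summits.AtomisticToContinuum.BoseEinsteinCondensation.Theses.BECBathMassLiouville

/-!
# `Assembly` (route BECBathMassLiouville, item stmt-AtomisticToContinuum-14387)

`Assembly := StaticResponseBound → SpaceTimeLiouville → ResponseLiouvilleGlue → ResidueCondensesAll →
BoundaryTransferWeak → BoseEinsteinCondensation` (the sub-problem Statement, by name).

It is inhabited by the route's deciding theorem `closes`: the glue `ResponseLiouvilleGlue` turns the
two ranked cruxes `StaticResponseBound` (finite compressibility at every wavelength) and
`SpaceTimeLiouville` (the per-potential engine) into the target `InsertionResidue`; the route's own
per-potential row `ResidueCondensesAll` turns the residue bound into constant-mode BEC of periodic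
near-minimisers at each repulsive finite-range `v`; the shared transfer `BoundaryTransferWeak`
(stmt-AtomisticToContinuum-0827) returns the Dirichlet conjunct `HasGroundStateBEC v ρ` for
`ρ < ρ₀(v)`. Pure logic; the analytic content lives in the five hypotheses.
-/

namespace Summit.AtomisticToContinuum.BoseEinsteinCondensation.Theorems

open Summit.AtomisticToContinuum.BoseEinsteinCondensation.Theses.BECBathMassLiouville

/-- **`Assembly`** (item stmt-AtomisticToContinuum-14387 of route BECBathMassLiouville, concluded BY
NAME): `StaticResponseBound → SpaceTimeLiouville → ResponseLiouvilleGlue → ResidueCondensesAll →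
BoundaryTransferWeak → BoseEinsteinCondensation`, by the route's deciding theorem `closes`
(`fun v hv => hT v hv (hR v hv (hG hK hE))`). [folklore] -/
theorem becBathMassLiouville_assembly_proof :
    Summit.AtomisticToContinuum.BoseEinsteinCondensation.Theses.BECBathMassLiouville.Assembly := by
  unfold Summit.AtomisticToContinuum.BoseEinsteinCondensation.Theses.BECBathMassLiouville.Assembly
  intro hK hE hG hR hT
  exact closes hK hE hG hR hT

end Summit.AtomisticToContinuum.BoseEinsteinCondensation.Theorems
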